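import Literature.NumberTheory.EllipticCurves.TwoIsogenySelmerGroupRankProofs
import Literature.NumberTheory.EllipticCurves.Curve346SelmerCertificatesA
import Literature.NumberTheory.EllipticCurves.BinaryQuarticGoodReductionSolubilityProofs
import Literature.NumberTheory.DiophantineGeometry.LindMordellQuarticsHassePrincipleFailure
import Literature.NumberTheory.QuadraticForms.PadicSquares
import Mathlib.Tactic.Simproc.Factors
import HarnessLib

/-!
# `9` explicit everywhere-locally-soluble classes of the `2`-isogeny Selmer group `S(-16, -420)` of
# `X' : y² = x³ + -16x² + -420x` — the homogeneous spaces `w² = d u⁴ + -16 u²z² + (-420/d) z⁴` without a rational point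
# that carry `Ш(X/ℚ)[φ]` for the rank-`1` curve `X = [0, 8, 0, 121, 0]` (Silverman, AEC X.4.9, X.6.5)

Topic `NumberTheory/EllipticCurves`. Second of three files (`Curve8x121RankDescent`, this, `Curve8x121NontrivialSha`). In the tree's vocabulary
`S'(8, 121) = S(-16, -420)`; it has at most `2^{ω(-420)+1} = 32` classes, of which `8` are images of rational
points of `X'` (third file). Here `9` further classes `d ∈ {-1, 2, -2, 3, 5, -5, 6, -6, 7}` are shown
everywhere locally soluble by EXPLICIT LOCAL POINTS: a real point; a `ℚ₂`-point (a value `4^m·c`, `c ≡ 1 (mod 8)`, tree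
`padicInt_isSquare_of_toZModPow_three_eq_one`); `ℚ_q`-points at the odd primes `q ∣ Δ = 2 ^ 14 * 3 * 5 * 7 * 11 ^ 4` (values `q^{2m}·c`,
`c` a non-zero square mod `q`, tree `exists_sq_eq_intCast`); good reduction elsewhere (tree
`BinaryQuartic.isSoluble_padic_of_not_dvd_disc`, Bhargava–Shankar Prop. 5.13). With the `8` point classes this gives
`17 > 16` members, so `dim₂ S(-16, -420) = 5` (third file): ALL classes are everywhere locally soluble.

Everything is re-verified by the kernel (the local points were found by a plain search). Theorems only.

## References

* [SilvermanAEC2009] J. H. Silverman, *AEC*, 2nd ed.: Prop. X.4.9, proof of Prop. X.6.2(b), Prop. X.6.5(a).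
* [BhargavaShankarAnnals2015] M. Bhargava, A. Shankar, Ann. of Math. 181 (2015), Prop. 5.13.
-/

noncomputable section

open scoped Classical

namespace Literature.NumberTheory.EllipticCurves

namespace Curve8x121

open Literature.NumberTheory.DiophantineGeometry.LindMordellQuartics (exists_sq_eq_intCast)
open Literature.NumberTheory.QuadraticForms (padicInt_isSquare_of_toZModPow_three_eq_one)

/-! ## Local-point helpers for the quartics `⟨d, 0, -16, 0, e⟩` -/

/-- `Δ(⟨d, 0, -16, 0, e⟩) = 16·de·(-16² − 4de)² = -25187205120` for `de = -420`. [cite: BhargavaShankarAnnals2015, §1.2 (discriminant formula)] -/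
theorem disc_C (d e : ℤ) (hde : d * e = -420) : (twoIsogenyQuartic (-16) d e).disc = -25187205120 := by
  simp only [twoIsogenyQuartic, BinaryQuartic.disc]
  linear_combination (256 * ((d * e) ^ 2 + -420 * (d * e) + 176400) - 128 * 256 * (d * e + -420) + 16 * 65536) * hde

/-- A prime dividing `-25187205120 = ±2 ^ 14 * 3 * 5 * 7 * 11 ^ 4` is one of `[2, 3, 5, 7, 11]` (the primes of bad reduction of the quartics).
[cite: BhargavaShankarAnnals2015, Prop. 5.13 (the primes p ∣ Δ(f))] -/
theorem prime_dvd_disc_cases {p : ℕ} (hp : p.Prime) (h : (p : ℤ) ∣ -25187205120) : p = 2 ∨ p = 3 ∨ p = 5 ∨ p = 7 ∨ p = 11 := by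
  have habs : p ∣ 25187205120 := by
    have := Int.natAbs_dvd_natAbs.mpr h
    simpa using this
  have h0 : p ∣ 2 ^ 14 * 3 * 5 * 7 * 11 ^ 4 := by
    rw [show (2 ^ 14 * 3 * 5 * 7 * 11 ^ 4 : ℕ) = 25187205120 by norm_num]
    exact habs
  rcases (Nat.Prime.dvd_mul hp).mp h0 with h0l | hr
  swap
  · exact Or.inr (Or.inr (Or.inr (Or.inr (((Nat.prime_dvd_prime_iff_eq hp (by norm_num : Nat.Prime 11)).mp (hp.dvd_of_dvd_pow hr))))))
  rcases (Nat.Prime.dvd_mul hp).mp h0l with h0ll | hr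
  swap
  · exact Or.inr (Or.inr (Or.inr (Or.inl ((Nat.prime_dvd_prime_iff_eq hp (by norm_num : Nat.Prime 7)).mp hr))))
  rcases (Nat.Prime.dvd_mul hp).mp h0ll with h0lll | hr
  swap
  · exact Or.inr (Or.inr (Or.inl ((Nat.prime_dvd_prime_iff_eq hp (by norm_num : Nat.Prime 5)).mp hr)))
  rcases (Nat.Prime.dvd_mul hp).mp h0lll with h0llll | hr
  swap
  · exact Or.inr (Or.inl ((Nat.prime_dvd_prime_iff_eq hp (by norm_num : Nat.Prime 3)).mp hr))
  exact Or.inl ((Nat.prime_dvd_prime_iff_eq hp (by norm_num : Nat.Prime 2)).mp (hp.dvd_of_dvd_pow h0llll))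

/-- A prime not dividing `-25187205120` (which `2` and `3` divide) is at least `5`.
[cite: BhargavaShankarAnnals2015, Prop. 5.13 (p ≥ 5 with p ∤ Δ)] -/
theorem five_le_of_not_dvd_disc {p : ℕ} (hp : p.Prime) (h : ¬ (p : ℤ) ∣ -25187205120) : 5 ≤ p := by
  by_contra hlt
  push Not at hlt
  interval_cases p
  · exact absurd hp (by decide)
  · exact absurd hp (by decide)
  · exact h (by norm_num)
  · exact h (by norm_num)
  · exact absurd hp (by decide)

/-- A real point from a positive value: `f(u, z) = v > 0` gives `(u, z, √v)`.
[cite: SilvermanAEC2009, Prop. X.6.5(a) (real points of the homogeneous spaces)] -/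
theorem isSoluble_real_of_pos {d e u z v : ℤ} (huz : u ≠ 0 ∨ z ≠ 0) (hv : 0 < v)
    (hval : d * u ^ 4 + -16 * u ^ 2 * z ^ 2 + e * z ^ 4 = v) :
    ((twoIsogenyQuartic (-16) d e).map (Int.castRingHom ℝ)).IsSoluble := by
  refine ⟨u, z, Real.sqrt v, ?_, ?_⟩
  · rcases huz with h | h
    · exact Or.inl (by exact_mod_cast h)
    · exact Or.inr (by exact_mod_cast h)
  · rw [eval_map_twoIsogenyQuartic, Real.sq_sqrt (by exact_mod_cast hv.le)]
    simp only [eq_intCast]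
    exact_mod_cast hval.symm

/-- A `ℚ_q`-point from a square root in `ℤ_q`: `f(u, z) = c·k²` with `r² = c` gives `(u, z, k r)`.
[cite: SilvermanAEC2009, proof of Prop. X.6.2(b) (local points by lifting square roots)] -/
theorem isSoluble_padic_of_sq {q : ℕ} [Fact q.Prime] {d e u z k c : ℤ} (huz : u ≠ 0 ∨ z ≠ 0)
    (hval : d * u ^ 4 + -16 * u ^ 2 * z ^ 2 + e * z ^ 4 = c * k ^ 2) {r : ℤ_[q]} (hr : r ^ 2 = c) :
    ((twoIsogenyQuartic (-16) d e).map (Int.castRingHom ℚ_[q])).IsSoluble := by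
  refine ⟨u, z, (k : ℚ_[q]) * r, ?_, ?_⟩
  · rcases huz with h | h
    · exact Or.inl (by exact_mod_cast h)
    · exact Or.inr (by exact_mod_cast h)
  · have h := congrArg ((↑) : ℤ_[q] → ℚ_[q]) hr
    push_cast at h
    have hv : ((d * u ^ 4 + -16 * u ^ 2 * z ^ 2 + e * z ^ 4 : ℤ) : ℚ_[q]) = ((c * k ^ 2 : ℤ) : ℚ_[q]) := by
      rw [hval]
    push_cast at hv
    rw [eval_map_twoIsogenyQuartic, mul_pow, h]
    simp only [eq_intCast]
    linear_combination -hv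

/-- Squarefreeness of a (small) integer from the factorisation of its absolute value. [folklore] -/
private theorem squarefree_int_of_natAbs {d : ℤ} {n : ℕ} (h : d.natAbs = n) (hn : n ≠ 0)
    (hnd : n.primeFactorsList.Nodup) : Squarefree d :=
  Int.squarefree_natAbs.mp (h ▸ (Nat.squarefree_iff_nodup_primeFactorsList hn).mpr hnd)

/-! ## The certificates (first part) -/

/-- **`C_{-1} : w² = -1u⁴ + -16u²z² + (420)z⁴` is everywhere locally soluble**: real point `(0, 1)` (value `420`); `ℚ₂`-point `(0, 1)` (value `2²·(105)`, `105 ≡ 1 (mod 8)`); `ℚ_{3}`-point `(1, 1)` (value `1²·(403)`, `≡ 1² (mod 3)`); `ℚ_{5}`-point `(1, 0)` (value `1²·(-1)`, `≡ 2² (mod 5)`); `ℚ_{7}`-point `(1, 1)` (value `1²·(403)`, `≡ 2² (mod 7)`); `ℚ_{11}`-point `(3, 5)` (value `11²·(2139)`, `≡ 4² (mod 11)`); good reduction at the other primes.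
[cite: SilvermanAEC2009, Prop. X.6.5(a) (the method: local points by Hensel's lemma)]
[cite: BhargavaShankarAnnals2015, Prop. 5.13 (good reduction implies local solubility)] -/
theorem isLocallySoluble_C_m1 : (twoIsogenyQuartic (-16) (-1) (420)).IsLocallySoluble := by
  refine ⟨isSoluble_real_of_pos (u := 0) (z := 1) (v := 420) (Or.inr (by norm_num)) (by norm_num) (by norm_num),
    fun p hp => ?_⟩
  have hP : p.Prime := hp.out
  by_cases hdvd : (p : ℤ) ∣ -25187205120
  · rcases prime_dvd_disc_cases hP hdvd with rfl | rfl | rfl | rfl | rfl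
    · obtain ⟨r, hr⟩ := Curve346.exists_sq_eq_two (c := 105) (by decide)
      exact isSoluble_padic_of_sq (u := 0) (z := 1) (k := 2) (Or.inr (by norm_num)) (by norm_num) hr
    · obtain ⟨r, hr⟩ := exists_sq_eq_intCast (q := 3) (by norm_num) (c := 403) (w := 1) (by norm_num) (by norm_num)
      exact isSoluble_padic_of_sq (u := 1) (z := 1) (k := 1) (Or.inl (by norm_num)) (by norm_num) hr
    · obtain ⟨r, hr⟩ := exists_sq_eq_intCast (q := 5) (by norm_num) (c := -1) (w := 2) (by norm_num) (by norm_num)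
      exact isSoluble_padic_of_sq (u := 1) (z := 0) (k := 1) (Or.inl (by norm_num)) (by norm_num) hr
    · obtain ⟨r, hr⟩ := exists_sq_eq_intCast (q := 7) (by norm_num) (c := 403) (w := 2) (by norm_num) (by norm_num)
      exact isSoluble_padic_of_sq (u := 1) (z := 1) (k := 1) (Or.inl (by norm_num)) (by norm_num) hr
    · obtain ⟨r, hr⟩ := exists_sq_eq_intCast (q := 11) (by norm_num) (c := 2139) (w := 4) (by norm_num) (by norm_num)
      exact isSoluble_padic_of_sq (u := 3) (z := 5) (k := 11) (Or.inl (by norm_num)) (by norm_num) hr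
  · exact BinaryQuartic.isSoluble_padic_of_not_dvd_disc (five_le_of_not_dvd_disc hP hdvd) _
      (by rw [disc_C (-1) (420) (by norm_num)]; exact hdvd)

/-- **`C_{2} : w² = 2u⁴ + -16u²z² + (-210)z⁴` is everywhere locally soluble**: real point `(1, 0)` (value `2`); `ℚ₂`-point `(1, 11)` (value `8²·(-48071)`, `-48071 ≡ 1 (mod 8)`); `ℚ_{3}`-point `(1, 1)` (value `1²·(-224)`, `≡ 1² (mod 3)`); `ℚ_{5}`-point `(1, 1)` (value `1²·(-224)`, `≡ 1² (mod 5)`); `ℚ_{7}`-point `(1, 0)` (value `1²·(2)`, `≡ 3² (mod 7)`); `ℚ_{11}`-point `(2, 1)` (value `11²·(-2)`, `≡ 3² (mod 11)`); good reduction at the other primes.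
[cite: SilvermanAEC2009, Prop. X.6.5(a) (the method: local points by Hensel's lemma)]
[cite: BhargavaShankarAnnals2015, Prop. 5.13 (good reduction implies local solubility)] -/
theorem isLocallySoluble_C_2 : (twoIsogenyQuartic (-16) (2) (-210)).IsLocallySoluble := by
  refine ⟨isSoluble_real_of_pos (u := 1) (z := 0) (v := 2) (Or.inl (by norm_num)) (by norm_num) (by norm_num),
    fun p hp => ?_⟩
  have hP : p.Prime := hp.out
  by_cases hdvd : (p : ℤ) ∣ -25187205120
  · rcases prime_dvd_disc_cases hP hdvd with rfl | rfl | rfl | rfl | rfl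
    · obtain ⟨r, hr⟩ := Curve346.exists_sq_eq_two (c := -48071) (by decide)
      exact isSoluble_padic_of_sq (u := 1) (z := 11) (k := 8) (Or.inl (by norm_num)) (by norm_num) hr
    · obtain ⟨r, hr⟩ := exists_sq_eq_intCast (q := 3) (by norm_num) (c := -224) (w := 1) (by norm_num) (by norm_num)
      exact isSoluble_padic_of_sq (u := 1) (z := 1) (k := 1) (Or.inl (by norm_num)) (by norm_num) hr
    · obtain ⟨r, hr⟩ := exists_sq_eq_intCast (q := 5) (by norm_num) (c := -224) (w := 1) (by norm_num) (by norm_num)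
      exact isSoluble_padic_of_sq (u := 1) (z := 1) (k := 1) (Or.inl (by norm_num)) (by norm_num) hr
    · obtain ⟨r, hr⟩ := exists_sq_eq_intCast (q := 7) (by norm_num) (c := 2) (w := 3) (by norm_num) (by norm_num)
      exact isSoluble_padic_of_sq (u := 1) (z := 0) (k := 1) (Or.inl (by norm_num)) (by norm_num) hr
    · obtain ⟨r, hr⟩ := exists_sq_eq_intCast (q := 11) (by norm_num) (c := -2) (w := 3) (by norm_num) (by norm_num)
      exact isSoluble_padic_of_sq (u := 2) (z := 1) (k := 11) (Or.inl (by norm_num)) (by norm_num) hr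
  · exact BinaryQuartic.isSoluble_padic_of_not_dvd_disc (five_le_of_not_dvd_disc hP hdvd) _
      (by rw [disc_C (2) (-210) (by norm_num)]; exact hdvd)

/-- **`C_{-2} : w² = -2u⁴ + -16u²z² + (210)z⁴` is everywhere locally soluble**: real point `(0, 1)` (value `210`); `ℚ₂`-point `(1, 9)` (value `16²·(5377)`, `5377 ≡ 1 (mod 8)`); `ℚ_{3}`-point `(1, 0)` (value `1²·(-2)`, `≡ 1² (mod 3)`); `ℚ_{5}`-point `(1, 2)` (value `1²·(3294)`, `≡ 2² (mod 5)`); `ℚ_{7}`-point `(1, 2)` (value `1²·(3294)`, `≡ 2² (mod 7)`); `ℚ_{11}`-point `(0, 1)` (value `1²·(210)`, `≡ 1² (mod 11)`); good reduction at the other primes.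
[cite: SilvermanAEC2009, Prop. X.6.5(a) (the method: local points by Hensel's lemma)]
[cite: BhargavaShankarAnnals2015, Prop. 5.13 (good reduction implies local solubility)] -/
theorem isLocallySoluble_C_m2 : (twoIsogenyQuartic (-16) (-2) (210)).IsLocallySoluble := by
  refine ⟨isSoluble_real_of_pos (u := 0) (z := 1) (v := 210) (Or.inr (by norm_num)) (by norm_num) (by norm_num),
    fun p hp => ?_⟩
  have hP : p.Prime := hp.out
  by_cases hdvd : (p : ℤ) ∣ -25187205120
  · rcases prime_dvd_disc_cases hP hdvd with rfl | rfl | rfl | rfl | rfl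
    · obtain ⟨r, hr⟩ := Curve346.exists_sq_eq_two (c := 5377) (by decide)
      exact isSoluble_padic_of_sq (u := 1) (z := 9) (k := 16) (Or.inl (by norm_num)) (by norm_num) hr
    · obtain ⟨r, hr⟩ := exists_sq_eq_intCast (q := 3) (by norm_num) (c := -2) (w := 1) (by norm_num) (by norm_num)
      exact isSoluble_padic_of_sq (u := 1) (z := 0) (k := 1) (Or.inl (by norm_num)) (by norm_num) hr
    · obtain ⟨r, hr⟩ := exists_sq_eq_intCast (q := 5) (by norm_num) (c := 3294) (w := 2) (by norm_num) (by norm_num)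
      exact isSoluble_padic_of_sq (u := 1) (z := 2) (k := 1) (Or.inl (by norm_num)) (by norm_num) hr
    · obtain ⟨r, hr⟩ := exists_sq_eq_intCast (q := 7) (by norm_num) (c := 3294) (w := 2) (by norm_num) (by norm_num)
      exact isSoluble_padic_of_sq (u := 1) (z := 2) (k := 1) (Or.inl (by norm_num)) (by norm_num) hr
    · obtain ⟨r, hr⟩ := exists_sq_eq_intCast (q := 11) (by norm_num) (c := 210) (w := 1) (by norm_num) (by norm_num)
      exact isSoluble_padic_of_sq (u := 0) (z := 1) (k := 1) (Or.inr (by norm_num)) (by norm_num) hr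
  · exact BinaryQuartic.isSoluble_padic_of_not_dvd_disc (five_le_of_not_dvd_disc hP hdvd) _
      (by rw [disc_C (-2) (210) (by norm_num)]; exact hdvd)

/-- **`C_{3} : w² = 3u⁴ + -16u²z² + (-140)z⁴` is everywhere locally soluble**: real point `(1, 0)` (value `3`); `ℚ₂`-point `(2, 1)` (value `2²·(-39)`, `-39 ≡ 1 (mod 8)`); `ℚ_{3}`-point `(0, 1)` (value `1²·(-140)`, `≡ 1² (mod 3)`); `ℚ_{5}`-point `(1, 2)` (value `1²·(-2301)`, `≡ 2² (mod 5)`); `ℚ_{7}`-point `(1, 1)` (value `1²·(-153)`, `≡ 1² (mod 7)`); `ℚ_{11}`-point `(0, 1)` (value `1²·(-140)`, `≡ 5² (mod 11)`); good reduction at the other primes.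
[cite: SilvermanAEC2009, Prop. X.6.5(a) (the method: local points by Hensel's lemma)]
[cite: BhargavaShankarAnnals2015, Prop. 5.13 (good reduction implies local solubility)] -/
theorem isLocallySoluble_C_3 : (twoIsogenyQuartic (-16) (3) (-140)).IsLocallySoluble := by
  refine ⟨isSoluble_real_of_pos (u := 1) (z := 0) (v := 3) (Or.inl (by norm_num)) (by norm_num) (by norm_num),
    fun p hp => ?_⟩
  have hP : p.Prime := hp.out
  by_cases hdvd : (p : ℤ) ∣ -25187205120
  · rcases prime_dvd_disc_cases hP hdvd with rfl | rfl | rfl | rfl | rfl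
    · obtain ⟨r, hr⟩ := Curve346.exists_sq_eq_two (c := -39) (by decide)
      exact isSoluble_padic_of_sq (u := 2) (z := 1) (k := 2) (Or.inl (by norm_num)) (by norm_num) hr
    · obtain ⟨r, hr⟩ := exists_sq_eq_intCast (q := 3) (by norm_num) (c := -140) (w := 1) (by norm_num) (by norm_num)
      exact isSoluble_padic_of_sq (u := 0) (z := 1) (k := 1) (Or.inr (by norm_num)) (by norm_num) hr
    · obtain ⟨r, hr⟩ := exists_sq_eq_intCast (q := 5) (by norm_num) (c := -2301) (w := 2) (by norm_num) (by norm_num)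
      exact isSoluble_padic_of_sq (u := 1) (z := 2) (k := 1) (Or.inl (by norm_num)) (by norm_num) hr
    · obtain ⟨r, hr⟩ := exists_sq_eq_intCast (q := 7) (by norm_num) (c := -153) (w := 1) (by norm_num) (by norm_num)
      exact isSoluble_padic_of_sq (u := 1) (z := 1) (k := 1) (Or.inl (by norm_num)) (by norm_num) hr
    · obtain ⟨r, hr⟩ := exists_sq_eq_intCast (q := 11) (by norm_num) (c := -140) (w := 5) (by norm_num) (by norm_num)
      exact isSoluble_padic_of_sq (u := 0) (z := 1) (k := 1) (Or.inr (by norm_num)) (by norm_num) hr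
  · exact BinaryQuartic.isSoluble_padic_of_not_dvd_disc (five_le_of_not_dvd_disc hP hdvd) _
      (by rw [disc_C (3) (-140) (by norm_num)]; exact hdvd)

/-- **`C_{5} : w² = 5u⁴ + -16u²z² + (-84)z⁴` is everywhere locally soluble**: real point `(1, 0)` (value `5`); `ℚ₂`-point `(1, 1)` (value `1²·(-95)`, `-95 ≡ 1 (mod 8)`); `ℚ_{3}`-point `(1, 1)` (value `1²·(-95)`, `≡ 1² (mod 3)`); `ℚ_{5}`-point `(0, 1)` (value `1²·(-84)`, `≡ 1² (mod 5)`); `ℚ_{7}`-point `(1, 2)` (value `1²·(-1403)`, `≡ 2² (mod 7)`); `ℚ_{11}`-point `(0, 1)` (value `1²·(-84)`, `≡ 2² (mod 11)`); good reduction at the other primes.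
[cite: SilvermanAEC2009, Prop. X.6.5(a) (the method: local points by Hensel's lemma)]
[cite: BhargavaShankarAnnals2015, Prop. 5.13 (good reduction implies local solubility)] -/
theorem isLocallySoluble_C_5 : (twoIsogenyQuartic (-16) (5) (-84)).IsLocallySoluble := by
  refine ⟨isSoluble_real_of_pos (u := 1) (z := 0) (v := 5) (Or.inl (by norm_num)) (by norm_num) (by norm_num),
    fun p hp => ?_⟩
  have hP : p.Prime := hp.out
  by_cases hdvd : (p : ℤ) ∣ -25187205120
  · rcases prime_dvd_disc_cases hP hdvd with rfl | rfl | rfl | rfl | rfl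
    · obtain ⟨r, hr⟩ := Curve346.exists_sq_eq_two (c := -95) (by decide)
      exact isSoluble_padic_of_sq (u := 1) (z := 1) (k := 1) (Or.inl (by norm_num)) (by norm_num) hr
    · obtain ⟨r, hr⟩ := exists_sq_eq_intCast (q := 3) (by norm_num) (c := -95) (w := 1) (by norm_num) (by norm_num)
      exact isSoluble_padic_of_sq (u := 1) (z := 1) (k := 1) (Or.inl (by norm_num)) (by norm_num) hr
    · obtain ⟨r, hr⟩ := exists_sq_eq_intCast (q := 5) (by norm_num) (c := -84) (w := 1) (by norm_num) (by norm_num)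
      exact isSoluble_padic_of_sq (u := 0) (z := 1) (k := 1) (Or.inr (by norm_num)) (by norm_num) hr
    · obtain ⟨r, hr⟩ := exists_sq_eq_intCast (q := 7) (by norm_num) (c := -1403) (w := 2) (by norm_num) (by norm_num)
      exact isSoluble_padic_of_sq (u := 1) (z := 2) (k := 1) (Or.inl (by norm_num)) (by norm_num) hr
    · obtain ⟨r, hr⟩ := exists_sq_eq_intCast (q := 11) (by norm_num) (c := -84) (w := 2) (by norm_num) (by norm_num)
      exact isSoluble_padic_of_sq (u := 0) (z := 1) (k := 1) (Or.inr (by norm_num)) (by norm_num) hr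
  · exact BinaryQuartic.isSoluble_padic_of_not_dvd_disc (five_le_of_not_dvd_disc hP hdvd) _
      (by rw [disc_C (5) (-84) (by norm_num)]; exact hdvd)

/-- `-1 ∈ S(-16, -420)`. [cite: SilvermanAEC2009, Prop. X.4.9] -/
theorem mem_S_m1 : (-1 : ℤ) ∈ twoIsogenySelmerGroup (-16) (-420) :=
  (mem_twoIsogenySelmerGroup_iff (by norm_num)).mpr
    ⟨squarefree_int_of_natAbs (n := 1) rfl (by norm_num) (by simp), by norm_num,
      by rw [show (-420 : ℤ) / -1 = 420 by norm_num]; exact isLocallySoluble_C_m1⟩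

/-- `2 ∈ S(-16, -420)`. [cite: SilvermanAEC2009, Prop. X.4.9] -/
theorem mem_S_2 : (2 : ℤ) ∈ twoIsogenySelmerGroup (-16) (-420) :=
  (mem_twoIsogenySelmerGroup_iff (by norm_num)).mpr
    ⟨squarefree_int_of_natAbs (n := 2) rfl (by norm_num) (by simp), by norm_num,
      by rw [show (-420 : ℤ) / 2 = -210 by norm_num]; exact isLocallySoluble_C_2⟩

/-- `-2 ∈ S(-16, -420)`. [cite: SilvermanAEC2009, Prop. X.4.9] -/
theorem mem_S_m2 : (-2 : ℤ) ∈ twoIsogenySelmerGroup (-16) (-420) :=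
  (mem_twoIsogenySelmerGroup_iff (by norm_num)).mpr
    ⟨squarefree_int_of_natAbs (n := 2) rfl (by norm_num) (by simp), by norm_num,
      by rw [show (-420 : ℤ) / -2 = 210 by norm_num]; exact isLocallySoluble_C_m2⟩

/-- `3 ∈ S(-16, -420)`. [cite: SilvermanAEC2009, Prop. X.4.9] -/
theorem mem_S_3 : (3 : ℤ) ∈ twoIsogenySelmerGroup (-16) (-420) :=
  (mem_twoIsogenySelmerGroup_iff (by norm_num)).mpr
    ⟨squarefree_int_of_natAbs (n := 3) rfl (by norm_num) (by simp), by norm_num,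
      by rw [show (-420 : ℤ) / 3 = -140 by norm_num]; exact isLocallySoluble_C_3⟩

/-- `5 ∈ S(-16, -420)`. [cite: SilvermanAEC2009, Prop. X.4.9] -/
theorem mem_S_5 : (5 : ℤ) ∈ twoIsogenySelmerGroup (-16) (-420) :=
  (mem_twoIsogenySelmerGroup_iff (by norm_num)).mpr
    ⟨squarefree_int_of_natAbs (n := 5) rfl (by norm_num) (by simp), by norm_num,
      by rw [show (-420 : ℤ) / 5 = -84 by norm_num]; exact isLocallySoluble_C_5⟩

end Curve8x121

end Literature.NumberTheory.EllipticCurves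

end
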